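import Literature.AlgebraicGeometry.Resolution.AlterationsMultisectionEtaleNhdChart
import Literature.AlgebraicGeometry.Resolution.SmoothStalksRegular
import Literature.AlgebraicGeometry.Resolution.SmoothLocusBaseChange
import Literature.AlgebraicGeometry.Dimension.FibreLocalRingDimension
import Mathlib.RingTheory.DiscreteValuationRing.TFAE
import HarnessLib

/-!
# The local ring of a one-dimensional fibre at a smooth closed point is a discrete valuation ring

Topic: `Literature/AlgebraicGeometry/Resolution`. For a morphism `f : X → Y` locally of finite
presentation and a point `x ∈ sm(f)`: the local ring `𝒪_{X_{f x}, x}` of the scheme-theoretic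
fibre at `x` is regular (`isRegularLocalRing_stalk_fiber_of_mem_smoothLocus`, Stacks 056S on a
smooth neighbourhood); if `x` is a closed point and all irreducible components of all fibres have
dimension `1`, it has dimension `1` (`ringKrullDim_stalk_fiber_eq_one`), hence is a discrete
valuation ring (`isDiscreteValuationRing_stalk_fiber`, stated as `∃ _ : IsDomain _, IsDiscreteValuationRing _`
since Mathlib's `IsDiscreteValuationRing` takes the domain structure as an instance argument). This is the local algebra behind
de Jong's "`(f⁻¹(y) ∩ sm(X/Y))_red` is a smooth curve" in the proof of Lemma 4.13
(de Jong 1996, p. 70).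

## References

* A. J. de Jong, *Smoothness, semi-stability and alterations*, Publ. Math. IHÉS 83 (1996),
  Lemma 4.13 (proof), p. 70. [DeJong1996]
* The Stacks Project, Tag 056S. [StacksProject]
-/

noncomputable section

universe u

open CategoryTheory AlgebraicGeometry Order Topology TopologicalSpace IsLocalRing

namespace Literature.AlgebraicGeometry.Resolution

variable {X Y : Scheme.{u}} (f : X ⟶ Y)

/-- **The local ring of a fibre at a smooth point is regular** (Stacks 056S applied to an open
neighbourhood of the point in the fibre, smooth over the residue field). [folklore] -/
theorem isRegularLocalRing_stalk_fiber_of_mem_smoothLocus [LocallyOfFinitePresentation f] {x : X}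
    (hx : x ∈ f.smoothLocus) :
    IsRegularLocalRing ((f.fiber (f x)).presheaf.stalk (f.asFiber x)) := by
  haveI : LocallyOfFinitePresentation (f.fiberToSpecResidueField (f x)) :=
    MorphismProperty.pullback_snd _ _ inferInstance
  have hx' : f.asFiber x ∈ (f.fiberToSpecResidueField (f x)).smoothLocus := by
    apply Scheme.Hom.preimage_smoothLocus_le_smoothLocus_pullback_snd f
      (Y.fromSpecResidueField (f x))
    show f.fiberι (f x) (f.asFiber x) ∈ f.smoothLocus
    rw [Scheme.Hom.fiberι_asFiber]
    exact hx
  obtain ⟨V, hxV, hsm⟩ :=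
    exists_smooth_ι_comp_of_mem_smoothLocus (f.fiberToSpecResidueField (f x)) hx'
  have hreg : IsRegularLocalRing ((V : Scheme.{u}).presheaf.stalk ⟨f.asFiber x, hxV⟩) :=
    @isRegularLocalRing_stalk_of_smooth_of_field _ _ _ (V.ι ≫ f.fiberToSpecResidueField (f x))
      hsm ⟨f.asFiber x, hxV⟩
  obtain ⟨e⟩ := Literature.AlgebraicGeometry.Motives.nonempty_stalk_ringEquiv_of_isIso_stalkMap
    V.ι ⟨f.asFiber x, hxV⟩ (f.asFiber x) rfl
  exact IsRegularLocalRing.of_ringEquiv e.symm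

/-- **The local ring of a fibre at a closed point has dimension one** when all irreducible
components of all fibres have dimension `1`: the point of the fibre is closed, hence not maximal
for specialisation (`not_isMax_of_finite_closure`), and `dim 𝒪_{X_y, x} = coheight x ≤ dim X_y = 1`.
[folklore] -/
theorem ringKrullDim_stalk_fiber_eq_one [LocallyOfFiniteType f]
    (hdim : ∀ (y : Y), ∀ C ∈ irreducibleComponents ↥(f.fiber y), topologicalKrullDim ↥C = 1)
    {x : X} (hx : IsClosed ({x} : Set X)) :
    ringKrullDim ((f.fiber (f x)).presheaf.stalk (f.asFiber x)) = 1 := by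
  haveI : LocallyOfFiniteType (f.fiberToSpecResidueField (f x)) :=
    MorphismProperty.pullback_snd _ _ inferInstance
  haveI : JacobsonSpace ↥(f.fiber (f x)) :=
    LocallyOfFiniteType.jacobsonSpace (f.fiberToSpecResidueField (f x))
  rw [ringKrullDim_stalk_eq_coheight]
  apply le_antisymm
  · -- `coheight ≤ dim X_y ≤ 1`
    have h1 : topologicalKrullDim ↥(f.fiber (f x)) ≤ (1 : ℕ) :=
      Literature.AlgebraicGeometry.Dimension.topologicalKrullDim_le_of_forall_mem_irreducibleComponents
        _ 1 fun C hC => (hdim (f x) C hC).le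
    rw [show topologicalKrullDim ↥(f.fiber (f x)) = krullDim ↥(f.fiber (f x)) from
      krullDim_eq_of_orderIso (irreducibleSetEquivPoints (α := ↥(f.fiber (f x))))] at h1
    exact_mod_cast (Order.coheight_le_krullDim _).trans h1
  · -- the closed point is not maximal
    have hcl : IsClosed ({f.asFiber x} : Set ↥(f.fiber (f x))) := by
      have : ({f.asFiber x} : Set ↥(f.fiber (f x))) = (f.fiberι (f x)) ⁻¹' {x} := by
        ext z
        simp only [Set.mem_singleton_iff, Set.mem_preimage]
        constructor
        · rintro rfl; exact f.fiberι_asFiber x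
        · intro hz
          apply (f.fiberι (f x)).isEmbedding.injective
          rw [hz, f.fiberι_asFiber]
      rw [this]
      exact hx.preimage (f.fiberι (f x)).continuous
    have hnm := not_isMax_of_finite_closure (hdim (f x)) (z := f.asFiber x)
      (by rw [hcl.closure_eq]; exact Set.finite_singleton _)
    by_contra hlt
    push Not at hlt
    have h0 : Order.coheight (f.asFiber x) = 0 := by
      have : Order.coheight (f.asFiber x) < 1 := by exact_mod_cast hlt
      simpa using this
    exact hnm (Order.coheight_eq_zero.mp h0)

/-- **The local ring of a fibre at a smooth closed point is a discrete valuation ring** (regular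
of dimension one). [folklore] -/
theorem isDiscreteValuationRing_stalk_fiber [LocallyOfFinitePresentation f]
    (hdim : ∀ (y : Y), ∀ C ∈ irreducibleComponents ↥(f.fiber y), topologicalKrullDim ↥C = 1)
    {x : X} (hx : IsClosed ({x} : Set X)) (hsm : x ∈ f.smoothLocus) :
    ∃ _ : IsDomain ((f.fiber (f x)).presheaf.stalk (f.asFiber x)),
      IsDiscreteValuationRing ((f.fiber (f x)).presheaf.stalk (f.asFiber x)) := by
  haveI hreg := isRegularLocalRing_stalk_fiber_of_mem_smoothLocus f hsm
  have h1 := ringKrullDim_stalk_fiber_eq_one f hdim hx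
  haveI : IsDomain ((f.fiber (f x)).presheaf.stalk (f.asFiber x)) :=
    isDomain_of_isRegularLocalRing ((f.fiber (f x)).presheaf.stalk (f.asFiber x))
  have hnf : ¬ IsField ((f.fiber (f x)).presheaf.stalk (f.asFiber x)) := fun hF => by
    have := ringKrullDim_eq_zero_of_isField hF
    rw [h1] at this
    exact one_ne_zero this
  have hcot : Module.finrank (ResidueField ((f.fiber (f x)).presheaf.stalk (f.asFiber x)))
      (CotangentSpace ((f.fiber (f x)).presheaf.stalk (f.asFiber x))) = 1 := by
    have := (IsRegularLocalRing.iff_finrank_cotangentSpace _).mp hreg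
    rw [h1] at this
    exact_mod_cast this
  exact ⟨inferInstance, ((IsDiscreteValuationRing.TFAE ((f.fiber (f x)).presheaf.stalk
    (f.asFiber x)) hnf).out 0 5).mpr hcot⟩

end Literature.AlgebraicGeometry.Resolution
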